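import Mathlib
import HarnessLib
import Summits.HubbardSuperconductivity.HubbardSuperconductivity.Theorems.WeakCouplingBCSKlThirdOrderSlot
import Summits.HubbardSuperconductivity.HubbardSuperconductivity.Theorems.ChiralWindowCwKLChiralWindowKernelHS
import Summits.HubbardSuperconductivity.HubbardSuperconductivity.Theorems.ChiralWindowCwKLChiralWindowD4Invariant

/-!
# WeakCouplingBCS — KL certificate: the Lindhard kernel is in `L⁴(σ_μ ⊗ σ_μ)`, hence the third-order CHAIN kernel is Hilbert–Schmidt
# at every `t′ = 0` level `μ ∈ (−4, 0)` (the `ChainHS` slot of `…KlThirdOrderFormBoundOfHS` is discharged in the companion `…KernelL4Window`)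

The tree's (K) `stub_klKernelHS` puts `χ₀(k + k')` in `L²(σ_μ ⊗ σ_μ)` by Stein's Minkowski route (`Literature…KohnLuttingerLindhardL2Bound`:
pointwise `F(q,p) ≤ (|ε_p − μ| + |ε_{p+q} − μ|)⁻¹`, layer cake with the torus-sublevel estimate (TSL, exponent `β`), `dp`-integrability from
the shell-volume estimate (SV)).  The SAME route works in `L⁴` — layer cake with exponent `4` gives `‖F(·,p)‖_{L⁴} ≲ |ε_p − μ|^{β/4 − 1}`, still
`dp`-integrable since `β > 0` — so:

* §1 `kl4_lintegral_inv_add_pow_four_le` — layer cake: `ν{X < s} ≤ C s^β` (`β < 4`) ⇒ `∫ (a + X)⁻⁴ dν ≤ (4C/(4−β)) a^{β−4}`;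
* §2 `kl4_eLpNorm_lindhardIntegrand_polar_le` — `‖F(γθ+γθ', p)‖_{L⁴(dθdθ')} ≤ (4C/(4−β))^{1/4} |ε_p − μ|^{β/4−1}` off the Fermi level;
* §3 `kl4_memLp_lindhardKernelPolar` — the polar kernel `χ₀(γθ + γθ')` is in `L⁴(dθ dθ')` (Minkowski, tree `MinkowskiIntegral`);
* §4 `kl4_kernel_memLp` — **`χ₀(k + k') ∈ L⁴(σ_μ ⊗ σ_μ)`** for `μ ∈ (−4, 0)` (transport by `σ_μ ≤ w₁ • γ_* dθ`, as in `…KernelHS`), and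
  `kl4_kernel_sub_memLp` — `χ₀(k − k') ∈ L⁴(σ_μ ⊗ σ_μ)` (inversion invariance of `σ_μ`, `stub_klD4Invariant` at `r²`);
* §5 **`kl4_chainKernel_memLp_two`** — the third-order chain kernel `χ₀(k−k')² + χ₀(k+k')²` is in `L²(σ_μ ⊗ σ_μ)` (squares of `L⁴`
  functions; `kl4_neg_measurePreserving`: `k ↦ −k` preserves `σ_μ`).
The slot consequences (`∃ H, ChainHS …`, window-uniform, and the form bound from a two-loop HS enclosure alone) are in the companion
`…KlLindhardKernelL4Window`.

Honest framing: QUALITATIVE (integrability, no number); the two-loop kernel `T_V + T_P` is untouched (its HS property is not proved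
anywhere); register expectation 0.00; a Kohn–Luttinger channel statement is not ODLRO and nothing here proves
superconductivity in the Hubbard model.  Filed `--supports stmt-HubbardSuperconductivity-0158`.

References: E. M. Stein, *Singular Integrals and Differentiability Properties of Functions* (1970), App. A.1; S. Raghu, S. A. Kivelson,
D. J. Scalapino, Phys. Rev. B 81 (2010) 224505, App. A.
-/

noncomputable section

-- the tree's namespace `Summit.<Summit>.<Problem>.Theorems` repeats the summit name by design (D-0017)
set_option linter.dupNamespace false

namespace Summit.HubbardSuperconductivity.HubbardSuperconductivity.Theorems

open Real Set Filter MeasureTheory MeasureTheory.Measure Literature.MathematicalPhysics.QuantumLattice KlThirdOrder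
open scoped Topology ENNReal NNReal

/-! ### §1 Layer cake with exponent four -/

/-- **Layer cake, exponent `4`**: if `X ≥ 0` has sublevel measures `ν{X < s} ≤ C s^β` (`β < 4`) then for `a > 0`,
`∫ ((a + X)⁻¹)⁴ dν ≤ (4C/(4−β)) · a^{β−4}`. [folklore] -/
theorem kl4_lintegral_inv_add_pow_four_le {Z : Type*} [MeasurableSpace Z] (ν : Measure Z) {X : Z → ℝ}
    (hX0 : ∀ z, 0 ≤ X z) (hXm : Measurable X) {C β : ℝ} (hC : 0 ≤ C) (hβ4 : β < 4)
    (hsub : ∀ s : ℝ, 0 < s → ν {z | X z < s} ≤ ENNReal.ofReal (C * s ^ β)) {a : ℝ} (ha : 0 < a) :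
    ∫⁻ z, ENNReal.ofReal (((a + X z)⁻¹) ^ 4) ∂ν ≤ ENNReal.ofReal (4 * C / (4 - β) * a ^ (β - 4)) := by
  set Y : Z → ℝ := fun z => (a + X z)⁻¹ with hY
  have hY0 : ∀ z, 0 ≤ Y z := fun z => inv_nonneg.2 (by linarith [hX0 z])
  have hYle : ∀ z, Y z ≤ a⁻¹ := fun z => by
    rw [hY]; exact inv_anti₀ ha (by linarith [hX0 z])
  have hYm : Measurable Y := (measurable_const.add hXm).inv
  have hlc := lintegral_rpow_eq_lintegral_meas_lt_mul ν (Eventually.of_forall hY0) hYm.aemeasurable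
    (p := 4) (by norm_num)
  have hrpow : (fun z => ENNReal.ofReal (Y z ^ (4 : ℝ))) = fun z => ENNReal.ofReal (((a + X z)⁻¹) ^ 4) := by
    funext z
    rw [show (4 : ℝ) = ((4 : ℕ) : ℝ) by norm_num, Real.rpow_natCast]
  rw [hrpow] at hlc
  rw [hlc]
  have hbound : ∀ t ∈ Ioi (0 : ℝ), ν {z | t < Y z} * ENNReal.ofReal (t ^ ((4 : ℝ) - 1)) ≤
      (Ioo (0 : ℝ) a⁻¹).indicator (fun t => ENNReal.ofReal (C * t ^ (3 - β))) t := by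
    intro t ht
    have ht0 : (0 : ℝ) < t := ht
    by_cases hta : t < a⁻¹
    · rw [indicator_of_mem (show t ∈ Ioo (0 : ℝ) a⁻¹ from ⟨ht0, hta⟩)]
      have hsubset : {z | t < Y z} ⊆ {z | X z < t⁻¹} := fun z (hz : t < Y z) => by
        show X z < t⁻¹
        have h1 : t < (a + X z)⁻¹ := hz
        have h2 : a + X z < t⁻¹ := by
          rw [lt_inv_comm₀ (by linarith [hX0 z]) ht0]; exact h1
        linarith
      calc ν {z | t < Y z} * ENNReal.ofReal (t ^ ((4 : ℝ) - 1))
          ≤ ENNReal.ofReal (C * (t⁻¹) ^ β) * ENNReal.ofReal (t ^ ((4 : ℝ) - 1)) :=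
            mul_le_mul_left ((measure_mono hsubset).trans (hsub _ (inv_pos.2 ht0))) _
        _ = ENNReal.ofReal (C * t ^ (3 - β)) := by
            rw [← ENNReal.ofReal_mul (by positivity)]
            congr 1
            rw [show (4 : ℝ) - 1 = 3 by norm_num, Real.inv_rpow ht0.le, ← Real.rpow_neg ht0.le,
              mul_assoc, ← Real.rpow_add ht0]
            congr 2; ring
    · rw [indicator_of_notMem (fun h : t ∈ Ioo (0 : ℝ) a⁻¹ => hta h.2)]
      have hempty : {z | t < Y z} = ∅ := by
        ext z
        simp only [mem_setOf_eq, mem_empty_iff_false, iff_false, not_lt]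
        exact (hYle z).trans (not_lt.1 hta)
      rw [hempty, measure_empty, zero_mul]
  have hint : IntegrableOn (fun t : ℝ => C * t ^ (3 - β)) (Ioo 0 a⁻¹) := by
    have h := (intervalIntegral.intervalIntegrable_rpow' (a := 0) (b := a⁻¹) (r := 3 - β) (by linarith)).1
    have h' : IntegrableOn (fun t : ℝ => t ^ (3 - β)) (Ioo 0 a⁻¹) := h.mono_set Ioo_subset_Ioc_self
    exact h'.const_mul C
  calc ENNReal.ofReal 4 * ∫⁻ t in Ioi 0, ν {z | t < Y z} * ENNReal.ofReal (t ^ ((4 : ℝ) - 1))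
      ≤ ENNReal.ofReal 4 * ∫⁻ t in Ioi 0, (Ioo (0 : ℝ) a⁻¹).indicator (fun t => ENNReal.ofReal (C * t ^ (3 - β))) t :=
        mul_le_mul_right (setLIntegral_mono' measurableSet_Ioi hbound) _
    _ = ENNReal.ofReal 4 * ∫⁻ t in Ioo 0 a⁻¹, ENNReal.ofReal (C * t ^ (3 - β)) := by
        congr 1
        rw [lintegral_indicator measurableSet_Ioo, Measure.restrict_restrict measurableSet_Ioo,
          inter_eq_left.2 (Ioo_subset_Ioi_self)]
    _ = ENNReal.ofReal 4 * ENNReal.ofReal (∫ t in Ioo 0 a⁻¹, C * t ^ (3 - β)) := by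
        rw [ofReal_integral_eq_lintegral_ofReal hint]
        exact (ae_restrict_iff' measurableSet_Ioo).2 (Eventually.of_forall fun t ht => by
          have : 0 ≤ t ^ (3 - β) := Real.rpow_nonneg ht.1.le _
          positivity)
    _ = ENNReal.ofReal (4 * C / (4 - β) * a ^ (β - 4)) := by
        rw [← ENNReal.ofReal_mul (by norm_num)]
        congr 1
        rw [integral_const_mul, ← integral_Ioc_eq_integral_Ioo, ← intervalIntegral.integral_of_le (inv_nonneg.2 ha.le),
          integral_rpow (Or.inl (by linarith))]
        rw [Real.zero_rpow (by linarith), sub_zero, Real.inv_rpow ha.le, ← Real.rpow_neg ha.le]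
        rw [show -(3 - β + 1) = β - 4 by ring]
        field_simp
        ring

/-! ### §2 The `L⁴(dθ dθ')` bound of a `p`-section of the polar Lindhard integrand -/

section Polar

variable {μ : ℝ} (hμ₁ : -4 < μ) (hμ₂ : μ < 0)
include hμ₁ hμ₂

/-- **`‖F(γθ + γθ', p)‖_{L⁴(dθdθ')} ≤ (4C/(4−β))^{1/4} · |ε_p − μ|^{β/4−1}`** for `p` off the Fermi level, given the torus sublevel estimate at
`(μ, p)` with `β < 4`. [folklore] -/
theorem kl4_eLpNorm_lindhardIntegrand_polar_le (p : Momentum) {C β : ℝ} (hC : 0 ≤ C) (hβ4 : β < 4)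
    (hTSL : ∀ s : ℝ, 0 < s →
      ((volume.restrict (Ioc (-π) π)).prod (volume.restrict (Ioc (-π) π)))
        {z : ℝ × ℝ | |squareDispersion 1 0 (p + (fermiPolar μ z.1 + fermiPolar μ z.2)) - μ| < s} ≤
        ENNReal.ofReal (C * s ^ β))
    (hp : squareDispersion 1 0 p ≠ μ) :
    eLpNorm (fun z : ℝ × ℝ => lindhardIntegrand (squareDispersion 1 0) μ (fermiPolar μ z.1 + fermiPolar μ z.2) p) 4
        ((volume.restrict (Ioc (-π) π)).prod (volume.restrict (Ioc (-π) π))) ≤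
      ENNReal.ofReal ((4 * C / (4 - β)) ^ (1 / (4 : ℝ)) * |squareDispersion 1 0 p - μ| ^ (β / 4 - 1)) := by
  set ν : Measure (ℝ × ℝ) := (volume.restrict (Ioc (-π) π)).prod (volume.restrict (Ioc (-π) π)) with hν
  set a : ℝ := |squareDispersion 1 0 p - μ| with ha
  have ha0 : 0 < a := abs_pos.2 (sub_ne_zero.2 hp)
  set X : ℝ × ℝ → ℝ := fun z => |squareDispersion 1 0 (p + (fermiPolar μ z.1 + fermiPolar μ z.2)) - μ| with hX
  have hXm : Measurable X := by
    have hc : Continuous fun z : ℝ × ℝ => squareDispersion 1 0 (p + (fermiPolar μ z.1 + fermiPolar μ z.2)) := by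
      have hε : Continuous (squareDispersion 1 0) := by unfold squareDispersion; fun_prop
      exact hε.comp (continuous_const.add (continuous_fermiPolar_sum hμ₁ hμ₂))
    exact (hc.sub continuous_const).abs.measurable
  set F : ℝ × ℝ → ℝ := fun z => lindhardIntegrand (squareDispersion 1 0) μ (fermiPolar μ z.1 + fermiPolar μ z.2) p
    with hF
  have hF0 : ∀ z, 0 ≤ F z := fun z => lindhardIntegrand_nonneg _ _ _ _
  have hFle : ∀ z, F z ≤ (a + X z)⁻¹ := fun z => (lindhardIntegrand_le_inv _ _ _ _).trans_eq (one_div _)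
  rw [eLpNorm_eq_lintegral_rpow_enorm_toReal (by norm_num : (4 : ℝ≥0∞) ≠ 0) ENNReal.ofNat_ne_top, ENNReal.toReal_ofNat]
  have hmono : ∫⁻ z, ‖F z‖ₑ ^ (4 : ℝ) ∂ν ≤ ∫⁻ z, ENNReal.ofReal (((a + X z)⁻¹) ^ 4) ∂ν := by
    refine lintegral_mono fun z => ?_
    rw [Real.enorm_eq_ofReal (hF0 z), ENNReal.ofReal_rpow_of_nonneg (hF0 z) (by norm_num),
      show (4 : ℝ) = ((4 : ℕ) : ℝ) by norm_num, Real.rpow_natCast]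
    exact ENNReal.ofReal_le_ofReal (pow_le_pow_left₀ (hF0 z) (hFle z) 4)
  have hlc := kl4_lintegral_inv_add_pow_four_le ν (fun z => abs_nonneg _) hXm hC hβ4 hTSL ha0
  have hK0 : 0 ≤ 4 * C / (4 - β) := div_nonneg (by positivity) (by linarith)
  calc (∫⁻ z, ‖F z‖ₑ ^ (4 : ℝ) ∂ν) ^ (1 / (4 : ℝ))
      ≤ (ENNReal.ofReal (4 * C / (4 - β) * a ^ (β - 4))) ^ (1 / (4 : ℝ)) :=
        ENNReal.rpow_le_rpow (hmono.trans hlc) (by norm_num)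
    _ = ENNReal.ofReal ((4 * C / (4 - β)) ^ (1 / (4 : ℝ)) * a ^ (β / 4 - 1)) := by
        rw [ENNReal.ofReal_rpow_of_nonneg (by positivity) (by norm_num)]
        congr 1
        rw [Real.mul_rpow hK0 (Real.rpow_nonneg ha0.le _), ← Real.rpow_mul ha0.le]
        congr 2; ring

/-- **`∫_{BZ} ‖F(γθ+γθ', p)‖_{L⁴(dθdθ')} dp < ∞`** given (TSL) uniformly in `p` (`0 < β < 4`) and (SV) at level `μ`. [folklore] -/
theorem kl4_lintegral_eLpNorm_lindhardIntegrand_polar_lt_top {C β Csh : ℝ} (hC : 0 ≤ C) (hβ0 : 0 < β) (hβ4 : β < 4)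
    (hCsh : 0 ≤ Csh)
    (hTSL : ∀ (p : Momentum) (s : ℝ), 0 < s →
      ((volume.restrict (Ioc (-π) π)).prod (volume.restrict (Ioc (-π) π)))
        {z : ℝ × ℝ | |squareDispersion 1 0 (p + (fermiPolar μ z.1 + fermiPolar μ z.2)) - μ| < s} ≤
        ENNReal.ofReal (C * s ^ β))
    (hSV : ∀ t : ℝ, 0 < t →
      volume (brillouinZone ∩ {p : Momentum | |squareDispersion 1 0 p - μ| < t}) ≤ ENNReal.ofReal (Csh * t)) :
    ∫⁻ p in brillouinZone, eLpNorm (fun z : ℝ × ℝ =>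
        lindhardIntegrand (squareDispersion 1 0) μ (fermiPolar μ z.1 + fermiPolar μ z.2) p) 4
      ((volume.restrict (Ioc (-π) π)).prod (volume.restrict (Ioc (-π) π))) < ⊤ := by
  set ν : Measure (ℝ × ℝ) := (volume.restrict (Ioc (-π) π)).prod (volume.restrict (Ioc (-π) π)) with hν
  set P : Measure Momentum := volume.restrict brillouinZone with hP
  set K : ℝ := (4 * C / (4 - β)) ^ (1 / (4 : ℝ)) with hK
  have hae : ∀ᵐ p ∂P, eLpNorm (fun z : ℝ × ℝ =>
      lindhardIntegrand (squareDispersion 1 0) μ (fermiPolar μ z.1 + fermiPolar μ z.2) p) 4 ν ≤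
      ENNReal.ofReal (K * |squareDispersion 1 0 p - μ| ^ (β / 4 - 1)) := by
    have hnull : ∀ᵐ p ∂P, squareDispersion 1 0 p ≠ μ := by
      rw [hP]
      refine ae_restrict_of_ae ?_
      rw [ae_iff]
      simp only [not_not]
      exact volume_levelSet_squareDispersion μ
    filter_upwards [hnull] with p hp
    exact kl4_eLpNorm_lindhardIntegrand_polar_le hμ₁ hμ₂ p hC hβ4 (hTSL p) hp
  have hfin : ∫⁻ p, ENNReal.ofReal (K * |squareDispersion 1 0 p - μ| ^ (β / 4 - 1)) ∂P < ⊤ := by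
    have hK0 : 0 ≤ K := Real.rpow_nonneg (div_nonneg (by positivity) (by linarith)) _
    have hrw : ∀ p, ENNReal.ofReal (K * |squareDispersion 1 0 p - μ| ^ (β / 4 - 1)) =
        ENNReal.ofReal K * ENNReal.ofReal (|squareDispersion 1 0 p - μ| ^ (-(1 - β / 4))) := fun p => by
      rw [← ENNReal.ofReal_mul hK0]
      congr 2
      rw [show -(1 - β / 4) = β / 4 - 1 by ring]
    simp_rw [hrw]
    rw [lintegral_const_mul _ (by
      have hε : Continuous (squareDispersion 1 0) := by unfold squareDispersion; fun_prop
      exact ENNReal.measurable_ofReal.comp (((hε.sub continuous_const).abs.measurable).pow_const _))]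
    refine ENNReal.mul_lt_top ENNReal.ofReal_lt_top ?_
    exact lintegral_rpow_neg_energy_lt_top (γ := 1 - β / 4) (by linarith) (by linarith) hCsh hSV
      volume_brillouinZone_lt_top.ne
  exact (lintegral_mono_ae hae).trans_lt hfin

/-! ### §3 The polar Lindhard kernel is in `L⁴(dθ dθ')` -/

/-- **The polar Lindhard kernel `(θ, θ') ↦ χ₀(γθ + γθ'; μ)` lies in `L⁴(dθ dθ' ⌞ (−π,π]²)`**, given (TSL) with `0 < β < 4` uniformly in `p`
and (SV) at level `μ` — Minkowski's integral inequality with `p = 4`. [cite: SteinSingularIntegrals1970, App. A.1] -/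
theorem kl4_memLp_lindhardKernelPolar_of {C β Csh : ℝ} (hC : 0 ≤ C) (hβ0 : 0 < β) (hβ4 : β < 4) (hCsh : 0 ≤ Csh)
    (hTSL : ∀ (p : Momentum) (s : ℝ), 0 < s →
      ((volume.restrict (Ioc (-π) π)).prod (volume.restrict (Ioc (-π) π)))
        {z : ℝ × ℝ | |squareDispersion 1 0 (p + (fermiPolar μ z.1 + fermiPolar μ z.2)) - μ| < s} ≤
        ENNReal.ofReal (C * s ^ β))
    (hSV : ∀ t : ℝ, 0 < t →
      volume (brillouinZone ∩ {p : Momentum | |squareDispersion 1 0 p - μ| < t}) ≤ ENNReal.ofReal (Csh * t)) :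
    MemLp (fun z : ℝ × ℝ => lindhardFunction (squareDispersion 1 0) μ (fermiPolar μ z.1 + fermiPolar μ z.2)) 4
      ((volume.restrict (Ioc (-π) π)).prod (volume.restrict (Ioc (-π) π))) := by
  set ν : Measure (ℝ × ℝ) := (volume.restrict (Ioc (-π) π)).prod (volume.restrict (Ioc (-π) π)) with hν
  set P : Measure Momentum := volume.restrict brillouinZone with hP
  set g : ℝ × ℝ → ℝ := fun z => ∫ p in brillouinZone,
    lindhardIntegrand (squareDispersion 1 0) μ (fermiPolar μ z.1 + fermiPolar μ z.2) p with hg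
  have hgm : AEStronglyMeasurable g ν := aestronglyMeasurable_integral_lindhardIntegrand_polar hμ₁ hμ₂
  have hMink : eLpNorm g 4 ν ≤ ∫⁻ p, eLpNorm (fun z : ℝ × ℝ =>
      lindhardIntegrand (squareDispersion 1 0) μ (fermiPolar μ z.1 + fermiPolar μ z.2) p) 4 ν ∂P := by
    have hF : AEStronglyMeasurable (Function.uncurry fun (z : ℝ × ℝ) (p : Momentum) =>
        lindhardIntegrand (squareDispersion 1 0) μ (fermiPolar μ z.1 + fermiPolar μ z.2) p) (ν.prod P) :=
      (measurable_lindhardIntegrand_polar hμ₁ hμ₂).aestronglyMeasurable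
    exact Literature.Analysis.FunctionSpaces.eLpNorm_integral_le_lintegral_eLpNorm hF (p := 4)
      (by norm_num) ENNReal.ofNat_ne_top
  have hg4 : MemLp g 4 ν :=
    ⟨hgm, hMink.trans_lt (kl4_lintegral_eLpNorm_lindhardIntegrand_polar_lt_top hμ₁ hμ₂ hC hβ0 hβ4 hCsh hTSL hSV)⟩
  have hfun : (fun z : ℝ × ℝ => lindhardFunction (squareDispersion 1 0) μ (fermiPolar μ z.1 + fermiPolar μ z.2)) =
      fun z => ((2 * π) ^ 2)⁻¹ * g z := by
    funext z
    simp only [lindhardFunction, hg]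
    rw [div_eq_inv_mul]
  rw [hfun]
  exact hg4.const_mul _

/-- **The polar Lindhard kernel is in `L⁴(dθ dθ')` for `−4 < μ < 0`, unconditionally** (TSL/SV from the tree's
`exists_torusSublevel_le` / `exists_shellVolume_le` on the degenerate band `[μ, μ]`). [folklore] -/
theorem kl4_memLp_lindhardKernelPolar :
    MemLp (fun z : ℝ × ℝ => lindhardFunction (squareDispersion 1 0) μ (fermiPolar μ z.1 + fermiPolar μ z.2)) 4
      ((volume.restrict (Ioc (-π) π)).prod (volume.restrict (Ioc (-π) π))) := by
  obtain ⟨C, β, hC, hβ0, hβ2, hTSL⟩ := exists_torusSublevel_le (μ₁ := μ) (μ₂ := μ) hμ₁ hμ₂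
  obtain ⟨Csh, hCsh, hSV⟩ := exists_shellVolume_le (μ₁ := μ) (μ₂ := μ) hμ₁ hμ₂
  have hμI : μ ∈ Icc μ μ := ⟨le_rfl, le_rfl⟩
  exact kl4_memLp_lindhardKernelPolar_of hμ₁ hμ₂ hC hβ0 (by linarith) hCsh (hTSL μ hμI) (hSV μ hμI)

/-! ### §4 Transport to the Fermi-curve measure: `χ₀(k + k')`, `χ₀(k − k')` in `L⁴(σ_μ ⊗ σ_μ)` -/

/-- **`χ₀(k + k') ∈ L⁴(σ_μ ⊗ σ_μ)`** for `μ ∈ (−4, 0)` (pull back through `γ × γ` and compare `σ_μ ⊗ σ_μ ≤ w₁² • (γ × γ)_* (dθ ⊗ dθ')`, verbatim the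
`L²` transport of `klhs_kernel_memLp`). [folklore] -/
theorem kl4_kernel_memLp :
    MemLp (fun z : Momentum × Momentum => lindhardFunction (squareDispersion 1 0) μ (z.1 + z.2)) 4
      ((fermiCurveMeasure (squareDispersion 1 0) μ).prod (fermiCurveMeasure (squareDispersion 1 0) μ)) := by
  obtain ⟨w₀, w₁, -, hw⟩ := exists_bounds_fermiPolarDOS hμ₁ hμ₂
  have hFm : Measurable (fermiPolar μ) := (continuous_fermiPolar hμ₁ hμ₂).measurable
  have hle := klhs_kernel_fermiCurveMeasure_le hμ₁ hμ₂ (fun θ => (hw θ).2)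
  have hfm : Measurable (fun z : Momentum × Momentum => lindhardFunction (squareDispersion 1 0) μ (z.1 + z.2)) :=
    (measurable_lindhardFunction (measurable_squareDispersion 1 0) μ).comp measurable_add
  have hmap : MemLp (fun z : Momentum × Momentum => lindhardFunction (squareDispersion 1 0) μ (z.1 + z.2)) 4
      (Measure.map (Prod.map (fermiPolar μ) (fermiPolar μ))
        ((volume.restrict (Ioc (-π) π)).prod (volume.restrict (Ioc (-π) π)))) :=
    (memLp_map_measure_iff hfm.aestronglyMeasurable (hFm.prodMap hFm).aemeasurable).2
      (kl4_memLp_lindhardKernelPolar hμ₁ hμ₂)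
  refine hmap.of_measure_le_smul (c := ENNReal.ofReal w₁ * ENNReal.ofReal w₁)
    (ENNReal.mul_ne_top ENNReal.ofReal_ne_top ENNReal.ofReal_ne_top) ?_
  calc (fermiCurveMeasure (squareDispersion 1 0) μ).prod (fermiCurveMeasure (squareDispersion 1 0) μ)
      ≤ (ENNReal.ofReal w₁ • Measure.map (fermiPolar μ) (volume.restrict (Ioc (-π) π))).prod
          (ENNReal.ofReal w₁ • Measure.map (fermiPolar μ) (volume.restrict (Ioc (-π) π))) :=
        Measure.prod_mono hle hle
    _ = (ENNReal.ofReal w₁ * ENNReal.ofReal w₁) • Measure.map (Prod.map (fermiPolar μ) (fermiPolar μ))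
          ((volume.restrict (Ioc (-π) π)).prod (volume.restrict (Ioc (-π) π))) := by
        rw [Measure.prod_smul_left, Measure.prod_smul_right, Measure.map_prod_map _ _ hFm hFm, smul_smul]

end Polar

/-! ### §5 Inversion invariance, the difference kernel, and the chain kernel in `L²` -/

/-- The square of a real `L⁴` function is in `L²`. [folklore] -/
theorem kl4_memLp_two_sq_of_memLp_four {α : Type*} [MeasurableSpace α] {ν : Measure α} {f : α → ℝ} (hf : MemLp f 4 ν) :
    MemLp (fun x => f x ^ 2) 2 ν := by
  have hmeas : AEStronglyMeasurable (fun x => f x ^ 2) ν := hf.1.pow 2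
  rw [memLp_two_iff_integrable_sq hmeas]
  have hi := hf.integrable_norm_rpow (by norm_num) (by norm_num)
  refine hi.congr (Eventually.of_forall fun x => ?_)
  simp only [ENNReal.toReal_ofNat, Real.norm_eq_abs]
  rw [show (4 : ℝ) = ((4 : ℕ) : ℝ) by norm_num, Real.rpow_natCast, pow_abs,
    abs_of_nonneg (by positivity : (0 : ℝ) ≤ f x ^ 4)]
  ring

section Chain

variable {μ : ℝ} (hμ₁ : -4 < μ) (hμ₂ : μ < 0)
include hμ₁ hμ₂

omit hμ₁ in
/-- **Inversion invariance**: `k ↦ −k` preserves the Fermi-curve measure `σ_μ` of `ε₀` (`rot² = −id`; tree `kl_d4_rot_measurePreserving`). [folklore] -/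
theorem kl4_neg_measurePreserving :
    MeasurePreserving (fun k : Momentum => -k) (fermiCurveMeasure (squareDispersion 1 0) μ)
      (fermiCurveMeasure (squareDispersion 1 0) μ) := by
  have h := (kl_d4_rot_measurePreserving stub_klGradient hμ₂).comp (kl_d4_rot_measurePreserving stub_klGradient hμ₂)
  have e : (rotMomentum ∘ rotMomentum) = fun k : Momentum => -k := by
    funext k
    ext i
    fin_cases i <;> simp [rotMomentum]
  rw [e] at h
  exact h

/-- **`χ₀(k − k') ∈ L⁴(σ_μ ⊗ σ_μ)`** (from `kl4_kernel_memLp` by the measure-preserving map `(k, k') ↦ (k, −k')`). [folklore] -/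
theorem kl4_kernel_sub_memLp :
    MemLp (fun z : Momentum × Momentum => lindhardFunction (squareDispersion 1 0) μ (z.1 - z.2)) 4
      ((fermiCurveMeasure (squareDispersion 1 0) μ).prod (fermiCurveMeasure (squareDispersion 1 0) μ)) := by
  haveI : IsFiniteMeasure (fermiCurveMeasure (squareDispersion 1 0) μ) :=
    stub_klFiniteMeasure stub_klGradient stub_klHausdorffFinite μ ⟨hμ₁, hμ₂⟩
  have hT : MeasurePreserving (Prod.map (id : Momentum → Momentum) (fun k : Momentum => -k))
      ((fermiCurveMeasure (squareDispersion 1 0) μ).prod (fermiCurveMeasure (squareDispersion 1 0) μ))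
      ((fermiCurveMeasure (squareDispersion 1 0) μ).prod (fermiCurveMeasure (squareDispersion 1 0) μ)) :=
    (MeasurePreserving.id _).prod (kl4_neg_measurePreserving hμ₂)
  have h := (kl4_kernel_memLp hμ₁ hμ₂).comp_measurePreserving hT
  have e : (fun z : Momentum × Momentum => lindhardFunction (squareDispersion 1 0) μ (z.1 + z.2)) ∘
      Prod.map (id : Momentum → Momentum) (fun k : Momentum => -k) =
      fun z : Momentum × Momentum => lindhardFunction (squareDispersion 1 0) μ (z.1 - z.2) := by
    funext z
    simp [sub_eq_add_neg]
  rw [e] at h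
  exact h

/-- **The third-order CHAIN kernel `χ₀(k−k')² + χ₀(k+k')²` is in `L²(σ_μ ⊗ σ_μ)`** for every `μ ∈ (−4, 0)`. [folklore] -/
theorem kl4_chainKernel_memLp_two :
    MemLp (fun z : Momentum × Momentum => chainKernel3 (squareDispersion 1 0) μ z.1 z.2) 2
      ((fermiCurveMeasure (squareDispersion 1 0) μ).prod (fermiCurveMeasure (squareDispersion 1 0) μ)) := by
  have h := (kl4_memLp_two_sq_of_memLp_four (kl4_kernel_sub_memLp hμ₁ hμ₂)).add
    (kl4_memLp_two_sq_of_memLp_four (kl4_kernel_memLp hμ₁ hμ₂))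
  have e : (fun z : Momentum × Momentum => lindhardFunction (squareDispersion 1 0) μ (z.1 - z.2) ^ 2) +
      (fun z : Momentum × Momentum => lindhardFunction (squareDispersion 1 0) μ (z.1 + z.2) ^ 2) =
      fun z : Momentum × Momentum => chainKernel3 (squareDispersion 1 0) μ z.1 z.2 := by
    funext z
    simp [chainKernel3]
  rw [e] at h
  exact h

end Chain

end Summit.HubbardSuperconductivity.HubbardSuperconductivity.Theorems

end
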